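import Mathlib
import Literature.Probability.LatticeModels.ConformalCovariance
import HarnessLib

/-!
# Reflect-invert covariance from special conformal covariance: `stub_reflectInvertOfSCT`

(Registered stub `stub_reflectInvertOfSCT` (G0) of line `multipole-ward-nonsat-endpoint` for the
crux `PrecisionLaplacian.MoebiusLimitOfTwoPointLaw`, item stmt-CriticalPhenomena-4801.)

For a unit vector `b ∈ ℝ³` let `R_b y = y − 2⟪b, y⟫ b` be the reflection in the plane `b^⊥` and
`ι y = y/‖y‖²` the unit inversion. The reflect-invert map `J_b := ι ∘ R_b`,
`J_b y = R_b y/‖y‖²`, is the word `τ_{−b} ∘ SCT_b ∘ τ_{−b}` in translations `τ` and the finite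
special conformal transformation `SCT_b x = (x + ‖x‖² b)/(1 + 2⟪b, x⟫ + ‖x‖²)`: indeed
`1 + 2⟪b, y − b⟫ + ‖y − b‖² = ‖y‖²` and `(y − b) + ‖y − b‖² b = (y − 2⟪b, y⟫ b) + ‖y‖² b`, so
`SCT_b (y − b) − b = R_b y/‖y‖²`. Consequently a translation-invariant family of `n`-point
functions which is covariant (weight `∏ᵢ (1 + 2⟪a, xᵢ⟫ + ‖a‖²‖xᵢ‖²)^Δ`) under every `SCT_a`
along pole-free paths is covariant under `J_b` with weight `∏ᵢ ‖yᵢ‖^{2Δ}`, at every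
configuration avoiding the point `b` and the closed ray `{−μ b : μ ≥ 0}`; the ray condition is
exactly pole-freeness of the SCT path of `yᵢ − b`, by the identity
`1 + 2s⟪b, yᵢ − b⟫ + s²‖yᵢ − b‖² = ‖(1 − s) b + s yᵢ‖²`. Pure inner-product algebra.

References: P. Di Francesco, P. Mathieu, D. Sénéchal, *Conformal Field Theory* (Springer 1997),
§4.1, eqs. (4.15)–(4.18) (special conformal transformations as `ι ∘ τ_b ∘ ι`).
-/

noncomputable section

open Literature.Probability.LatticeModels

namespace Summit.CriticalPhenomena.Ising3DConformalLimit.PrecisionLaplacianMoebiusLimitOfTwoPointLaw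

/-- The SCT path weight of `y − b` for a unit vector `b` is a square:
`1 + 2s⟪b, y − b⟫ + s²‖b‖²‖y − b‖² = ‖(1 − s) b + s y‖²`. [folklore] -/
theorem rinv_sctWeight_sub_unit_eq_norm_sq {b : EuclideanSpace ℝ (Fin 3)} (hb : ‖b‖ = 1)
    (y : EuclideanSpace ℝ (Fin 3)) (s : ℝ) :
    1 + 2 * s * inner ℝ b (y - b) + s ^ 2 * ‖b‖ ^ 2 * ‖y - b‖ ^ 2 =
      ‖(1 - s) • b + s • y‖ ^ 2 := by
  have hbb : inner ℝ b b = 1 := by rw [real_inner_self_eq_norm_sq, hb, one_pow]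
  rw [norm_add_sq_real, norm_sub_sq_real, norm_smul, norm_smul, inner_sub_right,
    real_inner_smul_left, real_inner_smul_right, real_inner_comm b y, hbb, hb,
    Real.norm_eq_abs, Real.norm_eq_abs, mul_pow, mul_pow, sq_abs, sq_abs]
  ring

/-- At `s = 1` the SCT weight of `y − b` (`‖b‖ = 1`) is `‖y‖²`:
`1 + 2⟪b, y − b⟫ + ‖b‖²‖y − b‖² = ‖y‖²`. [folklore] -/
theorem rinv_sctWeight_sub_unit_one {b : EuclideanSpace ℝ (Fin 3)} (hb : ‖b‖ = 1)
    (y : EuclideanSpace ℝ (Fin 3)) :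
    1 + 2 * inner ℝ b (y - b) + ‖b‖ ^ 2 * ‖y - b‖ ^ 2 = ‖y‖ ^ 2 := by
  have h := rinv_sctWeight_sub_unit_eq_norm_sq hb y 1
  rwa [mul_one, one_pow, one_mul, sub_self, zero_smul, one_smul, zero_add] at h

/-- The SCT numerator of `y − b` (`‖b‖ = 1`): `(y − b) + ‖y − b‖² b = (y − 2⟪b, y⟫ b) + ‖y‖² b`.
[folklore] -/
theorem rinv_sctNumerator_sub_unit {b : EuclideanSpace ℝ (Fin 3)} (hb : ‖b‖ = 1)
    (y : EuclideanSpace ℝ (Fin 3)) :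
    y - b + ‖y - b‖ ^ 2 • b = (y - (2 * inner ℝ b y) • b) + ‖y‖ ^ 2 • b := by
  rw [norm_sub_sq_real, hb, one_pow, real_inner_comm y b, add_smul, sub_smul, one_smul]
  abel

/-- For a unit vector `b`, if the SCT path weight of `y − b` vanishes at some `s ∈ [0, 1]` then
`y` lies on the closed ray `{−μ b : μ ≥ 0}`. [folklore] -/
theorem rinv_exists_ray_of_sctWeight_eq_zero {b : EuclideanSpace ℝ (Fin 3)} (hb : ‖b‖ = 1)
    {y : EuclideanSpace ℝ (Fin 3)} {s : ℝ} (hs : s ∈ Set.Icc (0 : ℝ) 1)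
    (h : 1 + 2 * s * inner ℝ b (y - b) + s ^ 2 * ‖b‖ ^ 2 * ‖y - b‖ ^ 2 = 0) :
    ∃ μ : ℝ, 0 ≤ μ ∧ y = -(μ • b) := by
  rw [rinv_sctWeight_sub_unit_eq_norm_sq hb, sq_eq_zero_iff, norm_eq_zero] at h
  rcases hs with ⟨hs0, hs1⟩
  rcases eq_or_lt_of_le hs0 with rfl | hs0'
  · rw [sub_zero, one_smul, zero_smul, add_zero] at h
    rw [h, norm_zero] at hb
    exact absurd hb zero_ne_one
  · refine ⟨(1 - s) / s, div_nonneg (sub_nonneg.2 hs1) hs0'.le, ?_⟩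
    have h1 : s • y = -((1 - s) • b) := eq_neg_of_add_eq_zero_right h
    calc y = s⁻¹ • (s • y) := by rw [smul_smul, inv_mul_cancel₀ hs0'.ne', one_smul]
      _ = -(((1 - s) / s) • b) := by rw [h1, smul_neg, smul_smul, div_eq_inv_mul]

/-- **Stub G0 (`stub_reflectInvertOfSCT`).** Translation invariance and special conformal
covariance along pole-free paths imply covariance under the reflect-invert maps
`J_b y = (y − 2⟪b, y⟫ b)/‖y‖²` (`‖b‖ = 1`) with weight `∏ᵢ (‖yᵢ‖²)^Δ`, at every configuration
avoiding the point `b` and the ray `{−μ b : μ ≥ 0}`: `J_b = τ_{−b} ∘ SCT_b ∘ τ_{−b}`.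
[folklore] -/
theorem stub_reflectInvertOfSCT :
    ∀ (S : CorrFamily 3) (Δ : ℝ), IsTranslationInvariant S →
      (∀ (n : ℕ) (a : EuclideanSpace ℝ (Fin 3)) (x : Fin n → EuclideanSpace ℝ (Fin 3)), (∀ i, x i ≠ 0) →
        (∀ i, ∀ s ∈ Set.Icc (0 : ℝ) 1, 1 + 2 * s * inner ℝ a (x i) + s ^ 2 * ‖a‖ ^ 2 * ‖x i‖ ^ 2 ≠ 0) →
        S n (fun i => (1 + 2 * inner ℝ a (x i) + ‖a‖ ^ 2 * ‖x i‖ ^ 2)⁻¹ • (x i + ‖x i‖ ^ 2 • a)) =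
          (∏ i, (1 + 2 * inner ℝ a (x i) + ‖a‖ ^ 2 * ‖x i‖ ^ 2) ^ Δ) * S n x) →
      ∀ (n : ℕ) (b : EuclideanSpace ℝ (Fin 3)), ‖b‖ = 1 → ∀ (y : Fin n → EuclideanSpace ℝ (Fin 3)),
        (∀ i, y i ≠ b) → (∀ i (μ : ℝ), 0 ≤ μ → y i ≠ -(μ • b)) →
        S n (fun i => (‖y i‖ ^ 2)⁻¹ • (y i - (2 * inner ℝ b (y i)) • b)) = (∏ i, (‖y i‖ ^ 2) ^ Δ) * S n y := by
  intro S Δ htr hSCT n b hb y hyb hyμ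
  have h0 : ∀ i, y i - b ≠ 0 := fun i => sub_ne_zero.2 (hyb i)
  have hpole : ∀ i, ∀ s ∈ Set.Icc (0 : ℝ) 1,
      1 + 2 * s * inner ℝ b (y i - b) + s ^ 2 * ‖b‖ ^ 2 * ‖y i - b‖ ^ 2 ≠ 0 := by
    intro i s hs h
    obtain ⟨μ, hμ, hy⟩ := rinv_exists_ray_of_sctWeight_eq_zero hb hs h
    exact hyμ i μ hμ hy
  have hy0 : ∀ i, ‖y i‖ ^ 2 ≠ 0 := fun i =>
    pow_ne_zero _ (norm_ne_zero_iff.2 fun h => hyμ i 0 le_rfl (by rw [zero_smul, neg_zero]; exact h))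
  have key := hSCT n b (fun i => y i - b) h0 hpole
  have hcfg : (fun i => (1 + 2 * inner ℝ b (y i - b) + ‖b‖ ^ 2 * ‖y i - b‖ ^ 2)⁻¹ •
      (y i - b + ‖y i - b‖ ^ 2 • b)) =
      fun i => (‖y i‖ ^ 2)⁻¹ • (y i - (2 * inner ℝ b (y i)) • b) + b := by
    funext i
    rw [rinv_sctWeight_sub_unit_one hb, rinv_sctNumerator_sub_unit hb, smul_add, smul_smul,
      inv_mul_cancel₀ (hy0 i), one_smul]
  have hprod : (∏ i, (1 + 2 * inner ℝ b (y i - b) + ‖b‖ ^ 2 * ‖y i - b‖ ^ 2) ^ Δ) =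
      ∏ i, (‖y i‖ ^ 2) ^ Δ :=
    Finset.prod_congr rfl fun i _ => by rw [rinv_sctWeight_sub_unit_one hb]
  have h2 : S n (fun i => y i - b) = S n y := by
    have h := htr n (-b) y
    simpa only [sub_eq_add_neg] using h
  rw [hcfg, hprod, htr n b (fun i => (‖y i‖ ^ 2)⁻¹ • (y i - (2 * inner ℝ b (y i)) • b)), h2] at key
  exact key

end Summit.CriticalPhenomena.Ising3DConformalLimit.PrecisionLaplacianMoebiusLimitOfTwoPointLaw

end
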